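import Summits.QuantumFields.YangMills.Theorems.ColdStartUniversalityLatticeLangevinPointwiseMixingUniform
import HarnessLib

/-!
# Route `ColdStartUniversality` (fixed-cut-off package, Bakry–Émery side, GRADIENT half): EVERY-START EXPONENTIAL MIXING OF SPATIALLY
# AVERAGED WILSON LOOPS, with a VOLUME-FREE constant

Helper file (seat `ym-line-csu-p1`, g29; `--supports stmt-QuantumFields-24809`).  The every-start mixing theorem
`wilson_pointwise_mixing_of_carre_uniform` (gradient bound + oscillation–carré du champ lemma + invariance) read on the spatially averaged
`R × T` Wilson loop `W̄_(R×T) = (#sites)⁻¹ Σ_x W_(R×T)(x; i, j)` through its `C⁵` coordinate functional (`loopAverage_coords_eq`,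
`contDiff_loopAverage`) and the carré du champ bound `Γ^A(W̄) ≤ 24ℓ²/#sites`, `ℓ = 2(R+T)` (`wilson_loopAverage_carre_le`); since
`#E = 3·#sites`, `π√#E·σ = 12√2·π·(R+T)` is VOLUME-FREE:
* ★★★ `wilson_loopAverage_pointwise_mixing_uniform` — `|κ_t(W̄_(R×T))(x) − ∫ W̄_(R×T) dμ_(β')| ≤ 12√2·π·(R+T)·e^(−(1−12|β'|)t)` for every
  realising kernel family, every `t` and EVERY start `x`;
* ★★★ `wilson_solution_loopAverage_pointwise_mixing_uniform` — the same along every strong SZZ solution from a deterministic start;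
* ★★ `wilsonLoop_pointwiseMixing_fixedCutoff_window` — the same at the route's cut-offs inside the window `γε_K > 6`.
THEOREMS ONLY, no definition, no sorry.  [cite: BakryGentilLedoux2014, Thm 3.3.18; ShenZhuZhu2022 §4 Cor. 4.7].
HONEST FRAMING: fixed cut-off and FIXED coupling `|β'| < 1/12`; uniform in `L`, the start and the time only; the route's scaling
`β'_K = (γε_K)⁻¹/2 → ∞` leaves the window, so nothing here is `K`-uniform; `UniformColdStartMixing` (stmt-24809, aside) is NOT restated
or weakened, and the Yang–Mills mass gap is NOT proved.
-/

set_option autoImplicit false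

noncomputable section

namespace Summit.QuantumFields.YangMills.Theorems.ColdStartUniversality

open MeasureTheory ProbabilityTheory Matrix Complex Finset Filter Set Metric
open scoped ComplexConjugate BigOperators Matrix NNReal ENNReal Topology
open Literature.Probability.Process Literature.MathematicalPhysics.QuantumFieldTheory
open Literature.MathematicalPhysics.QuantumFieldTheory.Balaban1983to89
open Literature.MathematicalPhysics.QuantumLattice (fundamentalRep fundamentalLatticeRep continuous_fundamentalRep fundamentalRep_apply)

variable {L : ℕ} [NeZero L]

/-- ★★★ **Every-start mixing of spatially averaged Wilson loops, volume-free.**  At `|β'| < 1/12`, for every torus size `L`, directions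
`i, j`, side lengths `R, T`, every Markov kernel family `κ` realising the SZZ solutions, every `t ≥ 0` and EVERY configuration `x`:
`|κ_t(W̄_(R×T))(x) − ∫ W̄_(R×T) dμ_(β')| ≤ 12√2·π·(R+T)·e^(−(1−12|β'|)t)`. [cite: BakryGentilLedoux2014, Thm 3.3.18; ShenZhuZhu2022 §4 Cor. 4.7] -/
theorem wilson_loopAverage_pointwise_mixing_uniform (L : ℕ) [NeZero L] (β' : ℝ) (hβ : |β'| < 1 / 12) (i j : Fin 3) (R T : ℕ)
    (κ : ℝ≥0 → Kernel (GaugeConfig 3 L (Matrix.specialUnitaryGroup (Fin 2) ℂ))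
      (GaugeConfig 3 L (Matrix.specialUnitaryGroup (Fin 2) ℂ))) [∀ t, IsMarkovKernel (κ t)]
    (hreal : ∀ (t : ℝ≥0) (x : GaugeConfig 3 L (Matrix.specialUnitaryGroup (Fin 2) ℂ))
        (Ω : Type) [MeasurableSpace Ω] (P : Measure Ω) [IsProbabilityMeasure P]
        (W : ℝ≥0 → Ω → (Edge 3 L × NoiseIdx 2 → ℝ)) (hW : IsFlatBrownian W P)
        (U : ℝ≥0 → Ω → GaugeConfig 3 L (Matrix.specialUnitaryGroup (Fin 2) ℂ)),
        (∀ ω, U 0 ω = x) →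
        (latticeLangevinDynamics (fundamentalLatticeRep 2) β').IsSolution (fundamentalRep (Fin 2))
          hW.natFiltration P W U →
        κ t x = P.map (U t))
    (t : ℝ≥0) (x : (GaugeConfig 3 L (Matrix.specialUnitaryGroup (Fin 2) ℂ))) :
    |∫ y, (((Fintype.card (Site 3 L) : ℝ))⁻¹ * ∑ x : Site 3 L, wilsonLoop (fundamentalRep (Fin 2)) x i j R T y) ∂(κ t x) - ∫ y, (((Fintype.card (Site 3 L) : ℝ))⁻¹ * ∑ x : Site 3 L, wilsonLoop (fundamentalRep (Fin 2)) x i j R T y) ∂(wilsonMeasure (d := 3) (L := L) (fundamentalRep (Fin 2)) β')| ≤ 12 * Real.sqrt 2 * Real.pi * ((R : ℝ) + T) * Real.exp (-((1 - 12 * |β'|) * (t : ℝ))) := by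
  classical
  haveI := secondCountableTopology_su2
  haveI := borelSpace_config L
  have hS : (0 : ℝ) < (Fintype.card (Site 3 L) : ℝ) := card_site_three_pos L
  set co : (GaugeConfig 3 L (Matrix.specialUnitaryGroup (Fin 2) ℂ)) → (Edge 3 L × Fin 2 × Fin 2 × Bool → ℝ) := (fun (V : GaugeConfig 3 L (Matrix.specialUnitaryGroup (Fin 2) ℂ)) (q : Edge 3 L × Fin (fundamentalLatticeRep 2).N × Fin (fundamentalLatticeRep 2).N × Bool) => (fun z : ℂ => if q.2.2.2 then z.im else z.re) ((fundamentalRep (Fin 2) (V q.1) : Matrix (Fin 2) (Fin 2) ℂ) q.2.1 q.2.2.1)) with hco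
  set fp : (Edge 3 L × Fin 2 × Fin 2 × Bool → ℝ) → ℝ := (fun y : (Edge 3 L × Fin 2 × Fin 2 × Bool → ℝ) => (2 * (Fintype.card (Site 3 L) : ℝ))⁻¹ * ∑ x : Site 3 L, ((((((List.range R).map (fun m : ℕ => ((Pi.single i ((m : ℕ) : ZMod L) : Site 3 L), i, false)) ++ (List.range T).map (fun m : ℕ => ((Pi.single i ((R : ℕ) : ZMod L) : Site 3 L) + (Pi.single j ((m : ℕ) : ZMod L) : Site 3 L), j, false)) ++ ((List.range R).map (fun m : ℕ => ((Pi.single j ((T : ℕ) : ZMod L) : Site 3 L) + (Pi.single i ((m : ℕ) : ZMod L) : Site 3 L), i, true))).reverse ++ ((List.range T).map (fun m : ℕ => ((Pi.single j ((m : ℕ) : ZMod L) : Site 3 L), j, true))).reverse).map (fun q : Site 3 L × Fin 3 × Bool => ((x + q.1, q.2.1), q.2.2))).map (fun a : Edge 3 L × Bool => if a.2 then ((fun (ee : Edge 3 L) => Matrix.of fun (i j : Fin 2) => ((y (ee, i, j, false) : ℝ) : ℂ) + ((y (ee, i, j, true) : ℝ) : ℂ) * Complex.I) a.1)ᴴ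 else (fun (ee : Edge 3 L) => Matrix.of fun (i j : Fin 2) => ((y (ee, i, j, false) : ℝ) : ℂ) + ((y (ee, i, j, true) : ℝ) : ℂ) * Complex.I) a.1)).prod)).trace.re) with hfp
  have hfpC : ContDiff ℝ 5 fp := contDiff_loopAverage _ _
  have hval : ∀ V : (GaugeConfig 3 L (Matrix.specialUnitaryGroup (Fin 2) ℂ)), fp (co V) = (((Fintype.card (Site 3 L) : ℝ))⁻¹ * ∑ x : Site 3 L, wilsonLoop (fundamentalRep (Fin 2)) x i j R T V) := fun V => loopAverage_coords_eq V i j R T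
  -- `Γ^A(fp) ≤ C = σ²` with `σ = √C`
  have hC0 : 0 ≤ 32 * ((2 * (Fintype.card (Site 3 L) : ℝ))⁻¹) ^ 2 * (((((List.range R).map (fun m : ℕ => ((Pi.single i ((m : ℕ) : ZMod L) : Site 3 L), i, false)) ++ (List.range T).map (fun m : ℕ => ((Pi.single i ((R : ℕ) : ZMod L) : Site 3 L) + (Pi.single j ((m : ℕ) : ZMod L) : Site 3 L), j, false)) ++ ((List.range R).map (fun m : ℕ => ((Pi.single j ((T : ℕ) : ZMod L) : Site 3 L) + (Pi.single i ((m : ℕ) : ZMod L) : Site 3 L), i, true))).reverse ++ ((List.range T).map (fun m : ℕ => ((Pi.single j ((m : ℕ) : ZMod L) : Site 3 L), j, true))).reverse)).length : ℕ) : ℝ) ^ 2 * Fintype.card (Edge 3 L) := by positivity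
  have hσ : 0 ≤ Real.sqrt (32 * ((2 * (Fintype.card (Site 3 L) : ℝ))⁻¹) ^ 2 * (((((List.range R).map (fun m : ℕ => ((Pi.single i ((m : ℕ) : ZMod L) : Site 3 L), i, false)) ++ (List.range T).map (fun m : ℕ => ((Pi.single i ((R : ℕ) : ZMod L) : Site 3 L) + (Pi.single j ((m : ℕ) : ZMod L) : Site 3 L), j, false)) ++ ((List.range R).map (fun m : ℕ => ((Pi.single j ((T : ℕ) : ZMod L) : Site 3 L) + (Pi.single i ((m : ℕ) : ZMod L) : Site 3 L), i, true))).reverse ++ ((List.range T).map (fun m : ℕ => ((Pi.single j ((m : ℕ) : ZMod L) : Site 3 L), j, true))).reverse)).length : ℕ) : ℝ) ^ 2 * Fintype.card (Edge 3 L)) := Real.sqrt_nonneg _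
  have hΓ := wilson_loopAverage_carre_le L β' (((List.range R).map (fun m : ℕ => ((Pi.single i ((m : ℕ) : ZMod L) : Site 3 L), i, false)) ++ (List.range T).map (fun m : ℕ => ((Pi.single i ((R : ℕ) : ZMod L) : Site 3 L) + (Pi.single j ((m : ℕ) : ZMod L) : Site 3 L), j, false)) ++ ((List.range R).map (fun m : ℕ => ((Pi.single j ((T : ℕ) : ZMod L) : Site 3 L) + (Pi.single i ((m : ℕ) : ZMod L) : Site 3 L), i, true))).reverse ++ ((List.range T).map (fun m : ℕ => ((Pi.single j ((m : ℕ) : ZMod L) : Site 3 L), j, true))).reverse)) ((2 * (Fintype.card (Site 3 L) : ℝ))⁻¹)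
  have h := wilson_pointwise_mixing_of_carre_uniform L β' hβ κ hreal hfpC hσ t (fun y => by
    rw [Real.sq_sqrt hC0]
    exact hΓ y) x
  -- the constant: `√#E · √C = 12√2 (R+T)`
  have hEC : (Fintype.card (Edge 3 L) : ℝ) * (32 * ((2 * (Fintype.card (Site 3 L) : ℝ))⁻¹) ^ 2 * (((((List.range R).map (fun m : ℕ => ((Pi.single i ((m : ℕ) : ZMod L) : Site 3 L), i, false)) ++ (List.range T).map (fun m : ℕ => ((Pi.single i ((R : ℕ) : ZMod L) : Site 3 L) + (Pi.single j ((m : ℕ) : ZMod L) : Site 3 L), j, false)) ++ ((List.range R).map (fun m : ℕ => ((Pi.single j ((T : ℕ) : ZMod L) : Site 3 L) + (Pi.single i ((m : ℕ) : ZMod L) : Site 3 L), i, true))).reverse ++ ((List.range T).map (fun m : ℕ => ((Pi.single j ((m : ℕ) : ZMod L) : Site 3 L), j, true))).reverse)).length : ℕ) : ℝ) ^ 2 * Fintype.card (Edge 3 L)) = (12 * Real.sqrt 2 * ((R : ℝ) + T)) ^ 2 := by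
    rw [rectShape_length, card_edge_eq_three_mul_card_site, mul_pow, mul_pow, Real.sq_sqrt (show (0:ℝ) ≤ 2 by norm_num)]
    push_cast
    field_simp
    ring
  have hroot : Real.sqrt (Fintype.card (Edge 3 L) : ℝ) * Real.sqrt (32 * ((2 * (Fintype.card (Site 3 L) : ℝ))⁻¹) ^ 2 * (((((List.range R).map (fun m : ℕ => ((Pi.single i ((m : ℕ) : ZMod L) : Site 3 L), i, false)) ++ (List.range T).map (fun m : ℕ => ((Pi.single i ((R : ℕ) : ZMod L) : Site 3 L) + (Pi.single j ((m : ℕ) : ZMod L) : Site 3 L), j, false)) ++ ((List.range R).map (fun m : ℕ => ((Pi.single j ((T : ℕ) : ZMod L) : Site 3 L) + (Pi.single i ((m : ℕ) : ZMod L) : Site 3 L), i, true))).reverse ++ ((List.range T).map (fun m : ℕ => ((Pi.single j ((m : ℕ) : ZMod L) : Site 3 L), j, true))).reverse)).length : ℕ) : ℝ) ^ 2 * Fintype.card (Edge 3 L)) = 12 * Real.sqrt 2 * ((R : ℝ) + T) := by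
    rw [← Real.sqrt_mul (Nat.cast_nonneg _), hEC, Real.sqrt_sq (by positivity)]
  have hfin : Real.pi * Real.sqrt (Fintype.card (Edge 3 L) : ℝ) * (Real.exp (-((1 - 12 * |β'|) * (t : ℝ))) * Real.sqrt (32 * ((2 * (Fintype.card (Site 3 L) : ℝ))⁻¹) ^ 2 * (((((List.range R).map (fun m : ℕ => ((Pi.single i ((m : ℕ) : ZMod L) : Site 3 L), i, false)) ++ (List.range T).map (fun m : ℕ => ((Pi.single i ((R : ℕ) : ZMod L) : Site 3 L) + (Pi.single j ((m : ℕ) : ZMod L) : Site 3 L), j, false)) ++ ((List.range R).map (fun m : ℕ => ((Pi.single j ((T : ℕ) : ZMod L) : Site 3 L) + (Pi.single i ((m : ℕ) : ZMod L) : Site 3 L), i, true))).reverse ++ ((List.range T).map (fun m : ℕ => ((Pi.single j ((m : ℕ) : ZMod L) : Site 3 L), j, true))).reverse)).length : ℕ) : ℝ) ^ 2 * Fintype.card (Edge 3 L))) =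
      12 * Real.sqrt 2 * Real.pi * ((R : ℝ) + T) * Real.exp (-((1 - 12 * |β'|) * (t : ℝ))) := by
    calc Real.pi * Real.sqrt (Fintype.card (Edge 3 L) : ℝ) * (Real.exp (-((1 - 12 * |β'|) * (t : ℝ))) * Real.sqrt (32 * ((2 * (Fintype.card (Site 3 L) : ℝ))⁻¹) ^ 2 * (((((List.range R).map (fun m : ℕ => ((Pi.single i ((m : ℕ) : ZMod L) : Site 3 L), i, false)) ++ (List.range T).map (fun m : ℕ => ((Pi.single i ((R : ℕ) : ZMod L) : Site 3 L) + (Pi.single j ((m : ℕ) : ZMod L) : Site 3 L), j, false)) ++ ((List.range R).map (fun m : ℕ => ((Pi.single j ((T : ℕ) : ZMod L) : Site 3 L) + (Pi.single i ((m : ℕ) : ZMod L) : Site 3 L), i, true))).reverse ++ ((List.range T).map (fun m : ℕ => ((Pi.single j ((m : ℕ) : ZMod L) : Site 3 L), j, true))).reverse)).length : ℕ) : ℝ) ^ 2 * Fintype.card (Edge 3 L)))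
        = Real.pi * (Real.sqrt (Fintype.card (Edge 3 L) : ℝ) * Real.sqrt (32 * ((2 * (Fintype.card (Site 3 L) : ℝ))⁻¹) ^ 2 * (((((List.range R).map (fun m : ℕ => ((Pi.single i ((m : ℕ) : ZMod L) : Site 3 L), i, false)) ++ (List.range T).map (fun m : ℕ => ((Pi.single i ((R : ℕ) : ZMod L) : Site 3 L) + (Pi.single j ((m : ℕ) : ZMod L) : Site 3 L), j, false)) ++ ((List.range R).map (fun m : ℕ => ((Pi.single j ((T : ℕ) : ZMod L) : Site 3 L) + (Pi.single i ((m : ℕ) : ZMod L) : Site 3 L), i, true))).reverse ++ ((List.range T).map (fun m : ℕ => ((Pi.single j ((m : ℕ) : ZMod L) : Site 3 L), j, true))).reverse)).length : ℕ) : ℝ) ^ 2 * Fintype.card (Edge 3 L))) * Real.exp (-((1 - 12 * |β'|) * (t : ℝ))) := by ring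
      _ = 12 * Real.sqrt 2 * Real.pi * ((R : ℝ) + T) * Real.exp (-((1 - 12 * |β'|) * (t : ℝ))) := by rw [hroot]; ring
  rw [hfin] at h
  rw [show (fun y : (GaugeConfig 3 L (Matrix.specialUnitaryGroup (Fin 2) ℂ)) => (((Fintype.card (Site 3 L) : ℝ))⁻¹ * ∑ x : Site 3 L, wilsonLoop (fundamentalRep (Fin 2)) x i j R T y)) = fun y => fp (co y) from funext fun y => (hval y).symm]
  exact h

/-- ★★★ **Every-start mixing of spatially averaged Wilson loops along EVERY SZZ solution, volume-free.**  At `|β'| < 1/12`: for every `L`,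
`i j`, `R T`, every filtered probability space carrying a flat Brownian driver, every strong solution `U` of the SZZ Langevin SDE from a
deterministic start `U_0 ≡ x₀` (e.g. the COLD start) and every `t ≥ 0`:  `|E[W̄_(R×T)(U_t)] − ∫ W̄_(R×T) dμ_(β')| ≤ 12√2·π·(R+T)·e^(−(1−12|β'|)t)`
— the expected averaged Wilson loops along the cold-start evolution reach their `μ_(β')`-means to accuracy `δ` after lattice time
`(1−12|β'|)⁻¹ log(12√2·π(R+T)/δ)`, uniformly in the volume. [cite: BakryGentilLedoux2014, Thm 3.3.18; ShenZhuZhu2022 §4 Cor. 4.7] -/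
theorem wilson_solution_loopAverage_pointwise_mixing_uniform (L : ℕ) [NeZero L] (β' : ℝ) (hβ : |β'| < 1 / 12) (i j : Fin 3) (R T : ℕ)
    (t : ℝ≥0) (x₀ : (GaugeConfig 3 L (Matrix.specialUnitaryGroup (Fin 2) ℂ)))
    (Ω : Type) [MeasurableSpace Ω] (P : Measure Ω) [IsProbabilityMeasure P]
    (W : ℝ≥0 → Ω → (Edge 3 L × NoiseIdx 2 → ℝ)) (hW : IsFlatBrownian W P)
    (U : ℝ≥0 → Ω → (GaugeConfig 3 L (Matrix.specialUnitaryGroup (Fin 2) ℂ))) (hU0 : ∀ ω, U 0 ω = x₀)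
    (hU : (latticeLangevinDynamics (fundamentalLatticeRep 2) β').IsSolution (fundamentalRep (Fin 2)) hW.natFiltration P W U) :
    |∫ ω, (((Fintype.card (Site 3 L) : ℝ))⁻¹ * ∑ x : Site 3 L, wilsonLoop (fundamentalRep (Fin 2)) x i j R T (U t ω)) ∂P - ∫ y, (((Fintype.card (Site 3 L) : ℝ))⁻¹ * ∑ x : Site 3 L, wilsonLoop (fundamentalRep (Fin 2)) x i j R T y) ∂(wilsonMeasure (d := 3) (L := L) (fundamentalRep (Fin 2)) β')| ≤ 12 * Real.sqrt 2 * Real.pi * ((R : ℝ) + T) * Real.exp (-((1 - 12 * |β'|) * (t : ℝ))) := by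
  classical
  haveI := secondCountableTopology_su2
  haveI := borelSpace_config L
  obtain ⟨κ, hκ, -, hreal⟩ := exists_transitionKernel L β'
  haveI := hκ
  have h := wilson_loopAverage_pointwise_mixing_uniform L β' hβ i j R T κ hreal t x₀
  have hlaw : κ t x₀ = P.map (U t) := hreal t x₀ Ω P W hW U hU0 hU
  have hmU : Measurable (U t) := (hU.adapted t).mono (hW.natFiltration.le t) le_rfl
  set co : (GaugeConfig 3 L (Matrix.specialUnitaryGroup (Fin 2) ℂ)) → (Edge 3 L × Fin 2 × Fin 2 × Bool → ℝ) := (fun (V : GaugeConfig 3 L (Matrix.specialUnitaryGroup (Fin 2) ℂ)) (q : Edge 3 L × Fin (fundamentalLatticeRep 2).N × Fin (fundamentalLatticeRep 2).N × Bool) => (fun z : ℂ => if q.2.2.2 then z.im else z.re) ((fundamentalRep (Fin 2) (V q.1) : Matrix (Fin 2) (Fin 2) ℂ) q.2.1 q.2.2.1)) with hco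
  set fp : (Edge 3 L × Fin 2 × Fin 2 × Bool → ℝ) → ℝ := (fun y : (Edge 3 L × Fin 2 × Fin 2 × Bool → ℝ) => (2 * (Fintype.card (Site 3 L) : ℝ))⁻¹ * ∑ x : Site 3 L, ((((((List.range R).map (fun m : ℕ => ((Pi.single i ((m : ℕ) : ZMod L) : Site 3 L), i, false)) ++ (List.range T).map (fun m : ℕ => ((Pi.single i ((R : ℕ) : ZMod L) : Site 3 L) + (Pi.single j ((m : ℕ) : ZMod L) : Site 3 L), j, false)) ++ ((List.range R).map (fun m : ℕ => ((Pi.single j ((T : ℕ) : ZMod L) : Site 3 L) + (Pi.single i ((m : ℕ) : ZMod L) : Site 3 L), i, true))).reverse ++ ((List.range T).map (fun m : ℕ => ((Pi.single j ((m : ℕ) : ZMod L) : Site 3 L), j, true))).reverse).map (fun q : Site 3 L × Fin 3 × Bool => ((x + q.1, q.2.1), q.2.2))).map (fun a : Edge 3 L × Bool => if a.2 then ((fun (ee : Edge 3 L) => Matrix.of fun (i j : Fin 2) => ((y (ee, i, j, false) : ℝ) : ℂ) + ((y (ee, i, j, true) : ℝ) : ℂ) * Complex.I) a.1)ᴴ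 else (fun (ee : Edge 3 L) => Matrix.of fun (i j : Fin 2) => ((y (ee, i, j, false) : ℝ) : ℂ) + ((y (ee, i, j, true) : ℝ) : ℂ) * Complex.I) a.1)).prod)).trace.re) with hfp
  have hfpC : ContDiff ℝ 5 fp := contDiff_loopAverage _ _
  have hval : ∀ V : (GaugeConfig 3 L (Matrix.specialUnitaryGroup (Fin 2) ℂ)), fp (co V) = (((Fintype.card (Site 3 L) : ℝ))⁻¹ * ∑ x : Site 3 L, wilsonLoop (fundamentalRep (Fin 2)) x i j R T V) := fun V => loopAverage_coords_eq V i j R T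
  have cY : Continuous fun y : (GaugeConfig 3 L (Matrix.specialUnitaryGroup (Fin 2) ℂ)) => (((Fintype.card (Site 3 L) : ℝ))⁻¹ * ∑ x : Site 3 L, wilsonLoop (fundamentalRep (Fin 2)) x i j R T y) := by
    rw [show (fun y : (GaugeConfig 3 L (Matrix.specialUnitaryGroup (Fin 2) ℂ)) => (((Fintype.card (Site 3 L) : ℝ))⁻¹ * ∑ x : Site 3 L, wilsonLoop (fundamentalRep (Fin 2)) x i j R T y)) = fun y => fp (co y) from funext fun y => (hval y).symm]
    exact hfpC.continuous.comp (continuous_coords (L := L))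
  have e1 : ∫ y, (((Fintype.card (Site 3 L) : ℝ))⁻¹ * ∑ x : Site 3 L, wilsonLoop (fundamentalRep (Fin 2)) x i j R T y) ∂(κ t x₀) = ∫ ω, (((Fintype.card (Site 3 L) : ℝ))⁻¹ * ∑ x : Site 3 L, wilsonLoop (fundamentalRep (Fin 2)) x i j R T (U t ω)) ∂P := by
    rw [hlaw, integral_map hmU.aemeasurable cY.aestronglyMeasurable]
  rw [← e1]
  exact h

/-- ★★ **Every-start mixing of spatially averaged Wilson loops at the route's cut-offs, inside the window `γε_K > 6`.**  For every cut-off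
`K` with `6 < γε_K`, directions `i, j`, side lengths `R, T`, every strong solution `U` of the SZZ SDE at `β'_K = (γε_K)⁻¹/2` on the `K`-th
lattice from a deterministic start (e.g. the cold start) and every lattice time `t`:
`|E[W̄_(R×T)(U_t)] − ∫ W̄_(R×T) dμ_K| ≤ 12√2·π·(R+T)·e^(−(1 − 6/(γε_K))t)`.  (Window-bound, NOT `K`-uniform: `6 < γε_K` fails as `ε_K → 0`.)
[cite: BakryGentilLedoux2014, Thm 3.3.18] -/
theorem wilsonLoop_pointwiseMixing_fixedCutoff_window (F : T3ContinuumYM3Torus.T3Family) (γ : ℝ) (K : ℕ) (hK : 6 < γ * (F.P K).eps)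
    (i j : Fin 3) (R T : ℕ) (t : ℝ≥0) (x₀ : GaugeConfig 3 ((F.P K).sitesPerDir 0) (Matrix.specialUnitaryGroup (Fin 2) ℂ))
    (Ω : Type) [MeasurableSpace Ω] (P : Measure Ω) [IsProbabilityMeasure P]
    (W : ℝ≥0 → Ω → (Edge 3 ((F.P K).sitesPerDir 0) × NoiseIdx 2 → ℝ)) (hW : IsFlatBrownian W P)
    (U : ℝ≥0 → Ω → GaugeConfig 3 ((F.P K).sitesPerDir 0) (Matrix.specialUnitaryGroup (Fin 2) ℂ)) (hU0 : ∀ ω, U 0 ω = x₀)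
    (hU : (latticeLangevinDynamics (fundamentalLatticeRep 2) ((γ * (F.P K).eps)⁻¹ / 2)).IsSolution (fundamentalRep (Fin 2)) hW.natFiltration P W U) :
    |∫ ω, (((((((F.P K).sitesPerDir 0) : ℕ) : ℝ) ^ 3))⁻¹ * ∑ x : Site 3 ((F.P K).sitesPerDir 0), wilsonLoop (fundamentalRep (Fin 2)) x i j R T (U t ω)) ∂P -
        ∫ y, (((((((F.P K).sitesPerDir 0) : ℕ) : ℝ) ^ 3))⁻¹ * ∑ x : Site 3 ((F.P K).sitesPerDir 0), wilsonLoop (fundamentalRep (Fin 2)) x i j R T y) ∂(wilsonMeasure (d := 3) (L := ((F.P K).sitesPerDir 0)) (fundamentalRep (Fin 2)) ((γ * (F.P K).eps)⁻¹ / 2))| ≤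
      12 * Real.sqrt 2 * Real.pi * ((R : ℝ) + T) * Real.exp (-((1 - 6 / (γ * (F.P K).eps)) * (t : ℝ))) := by
  obtain ⟨hβ, hrate⟩ := window_coupling_bounds F γ K hK
  have h := wilson_solution_loopAverage_pointwise_mixing_uniform ((F.P K).sitesPerDir 0) ((γ * (F.P K).eps)⁻¹ / 2) hβ i j R T t x₀ Ω P W hW U hU0 hU
  rw [(card_site_plaquette_fixedCutoff F K).1, hrate] at h
  exact h

end Summit.QuantumFields.YangMills.Theorems.ColdStartUniversality
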